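import Mathlib
import Summits.NavierStokesRegularity.NavierStokesRegularity.Theorems.FilamentSkeletonRssClause13ModelMourre
import Summits.NavierStokesRegularity.NavierStokesRegularity.Theorems.FilamentSkeletonRssClause13WeightedVirial

/-!
# Clause 13-J/13-R, brick B5 (band, FULL 1-D MODEL OPERATOR): the Mourre inequality WITH TRANSPORT AND LOCAL TERMS,
# `G(σ₀/√q)‖Y‖₂² ≤ (‖𝓛Y‖₂ + (Λ + b₁ + b₂)‖Y‖₂)·‖(τ−c)Y‖₂`,  `𝓛Y = iG·M_qY − wY′ + β₁Y + β₂Ȳ`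

Route `FilamentSkeletonRss`, ∃-side clause 13 (`Clause13RNearStraightL` stmt-NavierStokesRegularity-23612; typing-agnostic, valid verbatim for the
13-J twins); design of record `filament-plan/DESIGN-NOTE-28296-tenure-g22.md` §4:
"`2Re⟨DT·Y, (τ−c)Y⟩ = −(Γγ_j/(2πμ))·⟨Y, 𝔖′(μD)Y⟩ + ⟨Y, w·Y⟩ + 2⟨Y, (τ−c)·(sym B)·Y⟩` … ⇒ for `Y` frequency-localised where `𝔖′(μk) ≥ ½𝔖′(x*)`:
`‖DT·Y‖₂ ≥ [Γγ_j𝔖′(x*)/(4πμ) − 2(Λ + ‖B‖)R/cg]·(cg/(2R))·‖Y‖₂` … The transport term does NOT fight this estimate (it contributes the bounded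
multiplier `w`)".  The lane's `model_mourre_inequality` (p686548) is the self-operator case `𝓛 = M_q`.  This file adds the two remaining terms of the
1-D model of the linearised in-ball operator in complex (`J ↔ i`) notation,

  `𝓛Y := iG·M_qY − w·Y′ + β₁·Y + β₂·conj Y`,   `M_qY = (2/q)Y − K_q∗Y`,

with `G > 0` the own-core rotation scale, `w` the slip (REAL, differentiable, `w(c) = 0`, `|w′| ≤ Λ` — exactly the near-straight clause, which gives
`|w(τ)| ≤ Λ|τ−c|` globally), `β₁` (trace + rotation part) and `β₂` (anisotropic strain, the `conj`-linear part) bounded measurable multipliers: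

* §1 `re_I_mul_pairing_modelSelf_ge` — the band gain in pairing form, `(σ₀/√q)∫‖Y‖² ≤ Re(i·P_M)`, `P_M = ∫(M_qY)·conj Y·(τ−c)` (extracted from the
  proof of `model_mourre_inequality`);
* §2 `re_pairing_transport_eq` / `abs_re_pairing_transport_le` — transport: `Re ∫(−wY′)·conj Y·(τ−c) = ½∫(w + (τ−c)w′)|Y|²` (the weighted virial
  p672193) and `|…| ≤ Λ·‖(τ−c)Y‖₂‖Y‖₂`;
* §3 `norm_pairing_multiplier_le` — local terms: `|∫(β₁Y + β₂conj Y)·conj Y·(τ−c)| ≤ (b₁ + b₂)·‖(τ−c)Y‖₂‖Y‖₂`;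
* §4 `model_band_estimate` — **the full-model band inequality** `G(σ₀/√q)∫‖Y‖² ≤ ((∫‖𝓛Y‖²)^{1/2} + (Λ + b₁ + b₂)(∫‖Y‖²)^{1/2})·(∫‖(τ−c)Y‖²)^{1/2}`
  for band-localised `Y` (`Ŷ = 0` where `𝔖′(z√q) < σ₀`).  With `‖(τ−c)Y‖₂ ≲ R‖Y‖₂` (ball of radius `R`, up to the cut-off tails handled by
  `…Clause13CutoffCommutator`) this is the note's `‖𝓛Y‖₂ ≥ [Gσ₀/(√q·R) − Λ − ‖B‖]‖Y‖₂`: in the band the gain `G/R ~ Γ/(μR_b√(Γ log Γ))` beats the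
  `O(Λ + ‖B‖)` transport/strain terms for `Γ ≥ Γ₀`.
Lane ns-filament-19175-p1 g16; `--supports stmt-NavierStokesRegularity-23612 --as helper`.
HONEST FRAMING: an inequality about an explicit 1-D model operator attached to a HYPOTHETICAL filament skeleton on the NEGATIVE side of a MODEL route;
nothing here bears on Navier–Stokes regularity or blow-up; 23610/23612/23320 stay OPEN.
-/

noncomputable section

open MeasureTheory Real Complex Filter Set
open scoped FourierTransform ComplexConjugate Topology
open Summit.NavierStokesRegularity.NavierStokesRegularity.Theorems.AnalyticStripLiaSymbol (liaSym)

namespace Summit.NavierStokesRegularity.NavierStokesRegularity.Theorems.MatchedKernel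
set_option linter.dupNamespace false

/-! ## §1 The band gain in pairing form -/

/-- **Band gain, pairing form.**  Under the hypotheses of `model_mourre_inequality`:
`(σ₀/√q)·∫‖Y‖² ≤ Re(i·P_M)` with `P_M = ∫ (M_qY)(τ)·conj Y(τ)·(τ−c) dτ`. [folklore] -/
theorem re_I_mul_pairing_modelSelf_ge {q σ₀ : ℝ} (hq : 0 < q) {Y : ℝ → ℂ} (hYc : Continuous Y) (hY : Integrable Y) (hY2 : MemLp Y 2)
    (hxY : Integrable (fun x : ℝ => x • Y x)) (c : ℝ) (hwY2 : MemLp (fun τ : ℝ => ((τ - c : ℝ) : ℂ) * Y τ) 2)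
    (hM2 : MemLp (fun τ : ℝ => (2 / q : ℂ) * Y τ
      - ∫ σ : ℝ, ((((2 * q - (τ - σ) ^ 2) * (((τ - σ) ^ 2 + q) ^ (5 / 2 : ℝ))⁻¹ : ℝ)) : ℂ) * Y σ) 2)
    (hsupp : ∀ z : ℝ, deriv liaSym (z * √q) < σ₀ → ∫ x : ℝ, Y x * cexp (I * z * x) = 0) :
    σ₀ / √q * ∫ x : ℝ, ‖Y x‖ ^ 2
      ≤ (I * ∫ τ : ℝ, ((2 / q : ℂ) * Y τ
            - ∫ σ : ℝ, ((((2 * q - (τ - σ) ^ 2) * (((τ - σ) ^ 2 + q) ^ (5 / 2 : ℝ))⁻¹ : ℝ)) : ℂ) * Y σ)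
            * conj (Y τ) * ((τ - c : ℝ) : ℂ)).re := by
  have hwY : Integrable (fun τ : ℝ => ((τ - c : ℝ) : ℂ) * Y τ) := by
    have h1 : Integrable (fun τ : ℝ => (τ : ℂ) * Y τ) :=
      hxY.congr (Eventually.of_forall fun x => by simp [Complex.real_smul])
    have h2 : Integrable (fun τ : ℝ => (c : ℂ) * Y τ) := hY.const_mul _
    refine (h1.sub h2).congr (Eventually.of_forall fun τ => ?_)
    simp only [Pi.sub_apply]
    push_cast; ring
  have hgain := band_virial_ge_of_slice hq hY hY2 hsupp
  have hvir := band_virial_identity hq hYc hY hY2 hxY c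
  rw [Measure.volume_eq_prod, integral_prod_smoothingKernel_weight_eq_pairing hq hY hwY] at hvir
  set KY : ℝ → ℂ := fun τ => ∫ σ : ℝ, ((((2 * q - (τ - σ) ^ 2) * (((τ - σ) ^ 2 + q) ^ (5 / 2 : ℝ))⁻¹ : ℝ)) : ℂ) * Y σ
    with hKYdef
  have hKY2 : MemLp KY 2 := by
    have h := (hY2.const_mul (2 / q : ℂ)).sub hM2
    refine MemLp.ae_eq (Eventually.of_forall fun τ => ?_) h
    simp only [Pi.sub_apply]
    ring
  have h1 : Integrable (fun τ : ℝ => (2 / q : ℂ) * Y τ * conj (Y τ) * ((τ - c : ℝ) : ℂ)) :=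
    integrable_pairing (hY2.const_mul _) hwY2
  have h2 : Integrable (fun τ : ℝ => KY τ * conj (Y τ) * ((τ - c : ℝ) : ℂ)) := integrable_pairing hKY2 hwY2
  have hdrop := two_re_I_mul_pairing_modelSelf (q := q) (c := c) h1 h2
  have hsum : I * (∫ τ : ℝ, ((2 / q : ℂ) * Y τ - KY τ) * conj (Y τ) * ((τ - c : ℝ) : ℂ))
      + conj (I * ∫ τ : ℝ, ((2 / q : ℂ) * Y τ - KY τ) * conj (Y τ) * ((τ - c : ℝ) : ℂ))
      = ((((1 / (π * √q)) * ∫ z : ℝ, deriv liaSym (z * √q) * ‖∫ x : ℝ, Y x * cexp (I * z * x)‖ ^ 2) : ℝ) : ℂ) := by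
    rw [hdrop, hvir, neg_neg]
  set PM : ℂ := ∫ τ : ℝ, ((2 / q : ℂ) * Y τ - KY τ) * conj (Y τ) * ((τ - c : ℝ) : ℂ) with hPMdef
  have hre : (1 / (π * √q)) * ∫ z : ℝ, deriv liaSym (z * √q) * ‖∫ x : ℝ, Y x * cexp (I * z * x)‖ ^ 2
      = 2 * (I * PM).re := by
    have h := hsum
    rw [Complex.add_conj] at h
    exact_mod_cast h.symm
  calc σ₀ / √q * ∫ x : ℝ, ‖Y x‖ ^ 2 = (1 / 2) * (2 * σ₀ / √q * ∫ x : ℝ, ‖Y x‖ ^ 2) := by ring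
    _ ≤ (1 / 2) * ((1 / (π * √q)) * ∫ z : ℝ, deriv liaSym (z * √q) * ‖∫ x : ℝ, Y x * cexp (I * z * x)‖ ^ 2) :=
        mul_le_mul_of_nonneg_left hgain (by norm_num)
    _ = (I * PM).re := by rw [hre]; ring

/-! ## §2 The transport term in the pairing: `Re ∫(−wY′)·conj Y·(τ−c) = ½∫(w + (τ−c)w′)|Y|²`, bounded by `Λ‖(τ−c)Y‖₂‖Y‖₂` -/

/-- The slip vanishes at the waist and has `|w′| ≤ Λ`, hence `|w(τ)| ≤ Λ|τ − c|` (mean value inequality). [folklore] -/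
theorem abs_slip_le {w : ℝ → ℝ} (hw : Differentiable ℝ w) {Λ c : ℝ} (hΛ : ∀ t, |deriv w t| ≤ Λ) (hwc : w c = 0) (τ : ℝ) :
    |w τ| ≤ Λ * |τ - c| := by
  have h := Convex.norm_image_sub_le_of_norm_deriv_le (f := w) (s := Set.univ) (fun t _ => hw t)
    (fun t _ => by rw [Real.norm_eq_abs]; exact hΛ t) convex_univ (Set.mem_univ c) (Set.mem_univ τ)
  simpa only [Real.norm_eq_abs, hwc, sub_zero] using h

/-- Cauchy–Schwarz for the weight: `∫ |τ−c|·‖Y‖² ≤ (∫‖(τ−c)Y‖²)^{1/2}·(∫‖Y‖²)^{1/2}`. [folklore] -/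
theorem integral_abs_weight_mul_norm_sq_le {c : ℝ} {Y : ℝ → ℂ} (hY2 : MemLp Y 2)
    (hwY2 : MemLp (fun τ : ℝ => ((τ - c : ℝ) : ℂ) * Y τ) 2) :
    ∫ τ : ℝ, |τ - c| * ‖Y τ‖ ^ 2
      ≤ (∫ τ : ℝ, ‖((τ - c : ℝ) : ℂ) * Y τ‖ ^ 2) ^ (1 / 2 : ℝ) * (∫ τ : ℝ, ‖Y τ‖ ^ 2) ^ (1 / 2 : ℝ) := by
  have hpt : ∀ τ : ℝ, |τ - c| * ‖Y τ‖ ^ 2 = ‖((τ - c : ℝ) : ℂ) * Y τ‖ * ‖Y τ‖ := by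
    intro τ
    rw [norm_mul, Complex.norm_real, Real.norm_eq_abs]
    ring
  simp_rw [hpt]
  have hA' : MemLp (fun τ : ℝ => ‖((τ - c : ℝ) : ℂ) * Y τ‖) (ENNReal.ofReal 2) := by
    rw [show ENNReal.ofReal (2:ℝ) = 2 by simp]; exact hwY2.norm
  have hB' : MemLp (fun τ : ℝ => ‖Y τ‖) (ENNReal.ofReal 2) := by
    rw [show ENNReal.ofReal (2:ℝ) = 2 by simp]; exact hY2.norm
  have h := integral_mul_le_Lp_mul_Lq_of_nonneg Real.HolderConjugate.two_two
    (Eventually.of_forall fun τ => norm_nonneg (((τ - c : ℝ) : ℂ) * Y τ))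
    (Eventually.of_forall fun τ => norm_nonneg (Y τ)) hA' hB'
  simp only [Real.rpow_two] at h
  exact h

/-- `|τ−c|·‖Y‖²` is integrable when `Y, (τ−c)Y ∈ L²`. [folklore] -/
theorem integrable_abs_weight_mul_norm_sq {c : ℝ} {Y : ℝ → ℂ} (hY2 : MemLp Y 2)
    (hwY2 : MemLp (fun τ : ℝ => ((τ - c : ℝ) : ℂ) * Y τ) 2) :
    Integrable (fun τ : ℝ => |τ - c| * ‖Y τ‖ ^ 2) := by
  have h := hwY2.norm.integrable_mul hY2.norm
  refine h.congr (Eventually.of_forall fun τ => ?_)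
  simp only [Pi.mul_apply, norm_mul, Complex.norm_real, Real.norm_eq_abs]
  ring

/-- `w·Y′ ∈ L²` when `(τ−c)Y′ ∈ L²` and `|w| ≤ Λ|τ−c|`. [folklore] -/
theorem memLp_slip_mul {Y' : ℝ → ℂ} (hY'c : AEStronglyMeasurable Y' volume) {c : ℝ}
    (hwY'2 : MemLp (fun τ : ℝ => ((τ - c : ℝ) : ℂ) * Y' τ) 2)
    {w : ℝ → ℝ} (hw : Differentiable ℝ w) {Λ : ℝ} (hΛ : ∀ t, |deriv w t| ≤ Λ) (hwc : w c = 0) :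
    MemLp (fun τ : ℝ => ((w τ : ℝ) : ℂ) * Y' τ) 2 := by
  have hΛ0 : 0 ≤ Λ := (abs_nonneg _).trans (hΛ c)
  have hslip : ∀ τ, |w τ| ≤ Λ * |τ - c| := abs_slip_le hw hΛ hwc
  have hm : AEStronglyMeasurable (fun τ : ℝ => ((w τ : ℝ) : ℂ) * Y' τ) volume :=
    (Complex.continuous_ofReal.comp hw.continuous).aestronglyMeasurable.mul hY'c
  refine MemLp.of_le (hwY'2.const_mul (Λ : ℂ)) hm (Eventually.of_forall fun τ => ?_)
  simp only [norm_mul, Complex.norm_real, Real.norm_eq_abs, abs_of_nonneg hΛ0, ← mul_assoc]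
  exact mul_le_mul_of_nonneg_right (hslip τ) (norm_nonneg _)

/-- A bounded measurable multiplier keeps `L²`: `‖β‖ ≤ b` ⟹ `β·Z ∈ L²` for `Z ∈ L²`. [folklore] -/
theorem memLp_boundedMultiplier_mul {β Z : ℝ → ℂ} (hβ : AEStronglyMeasurable β volume) {b : ℝ} (hb : ∀ τ, ‖β τ‖ ≤ b)
    (hZ : MemLp Z 2) : MemLp (fun τ : ℝ => β τ * Z τ) 2 := by
  have hb0 : 0 ≤ b := (norm_nonneg _).trans (hb 0)
  refine MemLp.of_le (hZ.const_mul (b : ℂ)) (hβ.mul hZ.1) (Eventually.of_forall fun τ => ?_)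
  simp only [norm_mul, Complex.norm_real, Real.norm_eq_abs, abs_of_nonneg hb0]
  exact mul_le_mul_of_nonneg_right (hb τ) (norm_nonneg _)

/-- `conj Y ∈ L²` for `Y ∈ L²`. [folklore] -/
theorem memLp_conj {Y : ℝ → ℂ} (hY2 : MemLp Y 2) : MemLp (fun τ : ℝ => conj (Y τ)) 2 :=
  MemLp.of_le hY2 (Complex.continuous_conj.comp_aestronglyMeasurable hY2.1)
    (Eventually.of_forall fun τ => by rw [Complex.norm_conj])

/-- **Transport in the pairing (weighted virial).**  For `Y ∈ C¹` with `Y, (τ−c)Y, (τ−c)Y′ ∈ L²`, a differentiable real slip `w` with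
`w(c) = 0`, `|w′| ≤ Λ`:  the pairing `∫ (−w·Y′)·conj Y·(τ−c)` is integrable and `Re ∫ (−w·Y′)·conj Y·(τ−c) = ½ ∫ (w + (τ−c)w′)·‖Y‖²`. [folklore] -/
theorem re_pairing_transport_eq {Y Y' : ℝ → ℂ} (hY : ∀ τ, HasDerivAt Y (Y' τ) τ) (hY'c : Continuous Y') {c : ℝ} (hY2 : MemLp Y 2)
    (hwY2 : MemLp (fun τ : ℝ => ((τ - c : ℝ) : ℂ) * Y τ) 2) (hwY'2 : MemLp (fun τ : ℝ => ((τ - c : ℝ) : ℂ) * Y' τ) 2)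
    {w : ℝ → ℝ} (hw : Differentiable ℝ w) {Λ : ℝ} (hΛ : ∀ t, |deriv w t| ≤ Λ) (hwc : w c = 0) :
    Integrable (fun τ : ℝ => (-(((w τ : ℝ) : ℂ) * Y' τ)) * conj (Y τ) * ((τ - c : ℝ) : ℂ)) ∧
    (∫ τ : ℝ, (-(((w τ : ℝ) : ℂ) * Y' τ)) * conj (Y τ) * ((τ - c : ℝ) : ℂ)).re
      = (1 / 2) * ∫ τ : ℝ, (w τ + (τ - c) * deriv w τ) * ‖Y τ‖ ^ 2 := by
  have hYc : Continuous Y := continuous_iff_continuousAt.2 fun t => (hY t).continuousAt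
  have hwcont : Continuous w := hw.continuous
  have hΛ0 : 0 ≤ Λ := (abs_nonneg _).trans (hΛ c)
  have hslip : ∀ τ, |w τ| ≤ Λ * |τ - c| := abs_slip_le hw hΛ hwc
  -- products of the two weighted `L²` functions
  have hP1 : Integrable (fun τ : ℝ => ‖((τ - c : ℝ) : ℂ) * Y' τ‖ * ‖((τ - c : ℝ) : ℂ) * Y τ‖) :=
    hwY'2.norm.integrable_mul hwY2.norm
  have hP2 : Integrable (fun τ : ℝ => ‖((τ - c : ℝ) : ℂ) * Y τ‖ * ‖((τ - c : ℝ) : ℂ) * Y τ‖) :=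
    hwY2.norm.integrable_mul hwY2.norm
  -- (F) the pairing integrand is integrable: `|·| ≤ Λ·‖(τ−c)Y′‖·‖(τ−c)Y‖`
  have hFm : AEStronglyMeasurable (fun τ : ℝ => (-(((w τ : ℝ) : ℂ) * Y' τ)) * conj (Y τ) * ((τ - c : ℝ) : ℂ)) volume :=
    ((((Complex.continuous_ofReal.comp hwcont).mul hY'c).neg.mul (Complex.continuous_conj.comp hYc)).mul
      (Complex.continuous_ofReal.comp (continuous_id.sub continuous_const))).aestronglyMeasurable
  have hF : Integrable (fun τ : ℝ => (-(((w τ : ℝ) : ℂ) * Y' τ)) * conj (Y τ) * ((τ - c : ℝ) : ℂ)) := by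
    refine (hP1.const_mul Λ).mono' hFm (Eventually.of_forall fun τ => ?_)
    simp only [norm_mul, norm_neg, Complex.norm_conj, Complex.norm_real, Real.norm_eq_abs]
    calc |w τ| * ‖Y' τ‖ * ‖Y τ‖ * |τ - c| ≤ Λ * |τ - c| * ‖Y' τ‖ * ‖Y τ‖ * |τ - c| := by
          gcongr; exact hslip τ
      _ = Λ * (|τ - c| * ‖Y' τ‖ * (|τ - c| * ‖Y τ‖)) := by ring
  refine ⟨hF, ?_⟩
  -- (g), (h0), (h1): the hypotheses of the weighted virial identity
  have hg : Integrable (fun τ : ℝ => (((τ - c) * w τ : ℝ) : ℂ) * (conj (Y τ) * Y τ)) := by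
    have hm : AEStronglyMeasurable (fun τ : ℝ => (((τ - c) * w τ : ℝ) : ℂ) * (conj (Y τ) * Y τ)) volume :=
      ((Complex.continuous_ofReal.comp ((continuous_id.sub continuous_const).mul hwcont)).mul
        ((Complex.continuous_conj.comp hYc).mul hYc)).aestronglyMeasurable
    refine (hP2.const_mul Λ).mono' hm (Eventually.of_forall fun τ => ?_)
    simp only [norm_mul, Complex.norm_conj, Complex.norm_real, Real.norm_eq_abs]
    calc |τ - c| * |w τ| * (‖Y τ‖ * ‖Y τ‖) ≤ |τ - c| * (Λ * |τ - c|) * (‖Y τ‖ * ‖Y τ‖) := by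
          gcongr; exact hslip τ
      _ = Λ * (|τ - c| * ‖Y τ‖ * (|τ - c| * ‖Y τ‖)) := by ring
  have h0 : Integrable (fun τ : ℝ => ((w τ + (τ - c) * deriv w τ : ℝ) : ℂ) * (conj (Y τ) * Y τ)) := by
    have hm : AEStronglyMeasurable (fun τ : ℝ => ((w τ + (τ - c) * deriv w τ : ℝ) : ℂ) * (conj (Y τ) * Y τ)) volume := by
      have h1 : Measurable fun τ : ℝ => w τ + (τ - c) * deriv w τ :=
        hwcont.measurable.add ((measurable_id.sub measurable_const).mul (measurable_deriv w))
      exact ((Complex.measurable_ofReal.comp h1).aestronglyMeasurable).mul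
        (((Complex.continuous_conj.comp hYc).mul hYc).aestronglyMeasurable)
    refine ((integrable_abs_weight_mul_norm_sq hY2 hwY2).const_mul (2 * Λ)).mono' hm (Eventually.of_forall fun τ => ?_)
    simp only [norm_mul, Complex.norm_conj, Complex.norm_real, Real.norm_eq_abs]
    have hb : |w τ + (τ - c) * deriv w τ| ≤ 2 * Λ * |τ - c| := by
      calc |w τ + (τ - c) * deriv w τ| ≤ |w τ| + |(τ - c) * deriv w τ| := abs_add_le _ _
        _ = |w τ| + |τ - c| * |deriv w τ| := by rw [abs_mul]
        _ ≤ Λ * |τ - c| + |τ - c| * Λ := by gcongr; exacts [hslip τ, hΛ τ]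
        _ = 2 * Λ * |τ - c| := by ring
    calc |w τ + (τ - c) * deriv w τ| * (‖Y τ‖ * ‖Y τ‖) ≤ 2 * Λ * |τ - c| * (‖Y τ‖ * ‖Y τ‖) := by gcongr
      _ = 2 * Λ * (|τ - c| * ‖Y τ‖ ^ 2) := by ring
  have h1 : Integrable (fun τ : ℝ => (((τ - c) * w τ : ℝ) : ℂ) * (conj (Y' τ) * Y τ + conj (Y τ) * Y' τ)) := by
    have hm : AEStronglyMeasurable (fun τ : ℝ => (((τ - c) * w τ : ℝ) : ℂ) * (conj (Y' τ) * Y τ + conj (Y τ) * Y' τ)) volume :=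
      ((Complex.continuous_ofReal.comp ((continuous_id.sub continuous_const).mul hwcont)).mul
        (((Complex.continuous_conj.comp hY'c).mul hYc).add ((Complex.continuous_conj.comp hYc).mul hY'c))).aestronglyMeasurable
    refine (hP1.const_mul (2 * Λ)).mono' hm (Eventually.of_forall fun τ => ?_)
    rw [norm_mul, Complex.norm_real, Real.norm_eq_abs, abs_mul]
    have hs : ‖conj (Y' τ) * Y τ + conj (Y τ) * Y' τ‖ ≤ 2 * (‖Y' τ‖ * ‖Y τ‖) := by
      calc ‖conj (Y' τ) * Y τ + conj (Y τ) * Y' τ‖ ≤ ‖conj (Y' τ) * Y τ‖ + ‖conj (Y τ) * Y' τ‖ := norm_add_le _ _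
        _ = 2 * (‖Y' τ‖ * ‖Y τ‖) := by rw [norm_mul, norm_mul, Complex.norm_conj, Complex.norm_conj]; ring
    calc |τ - c| * |w τ| * ‖conj (Y' τ) * Y τ + conj (Y τ) * Y' τ‖
        ≤ |τ - c| * (Λ * |τ - c|) * (2 * (‖Y' τ‖ * ‖Y τ‖)) := by gcongr; exact hslip τ
      _ = 2 * Λ * (‖((τ - c : ℝ) : ℂ) * Y' τ‖ * ‖((τ - c : ℝ) : ℂ) * Y τ‖) := by
          rw [norm_mul, norm_mul, Complex.norm_real, Real.norm_eq_abs]; ring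
  have hvir := transport_virial_eq hY (fun τ => (hw τ).hasDerivAt) c hg h0 h1
  -- real part of the pairing, pointwise
  have hre_pt : ∀ τ : ℝ, ((-(((w τ : ℝ) : ℂ) * Y' τ)) * conj (Y τ) * ((τ - c : ℝ) : ℂ)).re
      = -(1 / 2 : ℝ) * ((τ - c) * w τ * (2 * (conj (Y τ) * Y' τ).re)) := by
    intro τ
    have h : (-(((w τ : ℝ) : ℂ) * Y' τ)) * conj (Y τ) * ((τ - c : ℝ) : ℂ)
        = ((-((τ - c) * w τ) : ℝ) : ℂ) * (conj (Y τ) * Y' τ) := by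
      push_cast; ring
    rw [h, Complex.re_ofReal_mul]
    ring
  have hreInt := Complex.reCLM.integral_comp_comm hF
  simp only [Complex.reCLM_apply] at hreInt
  rw [← hreInt]
  simp_rw [hre_pt]
  rw [integral_const_mul, hvir]
  ring

/-- **Transport bound**: `|Re ∫ (−w·Y′)·conj Y·(τ−c)| ≤ Λ·(∫‖(τ−c)Y‖²)^{1/2}·(∫‖Y‖²)^{1/2}`. [folklore] -/
theorem abs_re_pairing_transport_le {Y Y' : ℝ → ℂ} (hY : ∀ τ, HasDerivAt Y (Y' τ) τ) (hY'c : Continuous Y') {c : ℝ} (hY2 : MemLp Y 2)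
    (hwY2 : MemLp (fun τ : ℝ => ((τ - c : ℝ) : ℂ) * Y τ) 2) (hwY'2 : MemLp (fun τ : ℝ => ((τ - c : ℝ) : ℂ) * Y' τ) 2)
    {w : ℝ → ℝ} (hw : Differentiable ℝ w) {Λ : ℝ} (hΛ : ∀ t, |deriv w t| ≤ Λ) (hwc : w c = 0) :
    |(∫ τ : ℝ, (-(((w τ : ℝ) : ℂ) * Y' τ)) * conj (Y τ) * ((τ - c : ℝ) : ℂ)).re|
      ≤ Λ * ((∫ τ : ℝ, ‖((τ - c : ℝ) : ℂ) * Y τ‖ ^ 2) ^ (1 / 2 : ℝ) * (∫ τ : ℝ, ‖Y τ‖ ^ 2) ^ (1 / 2 : ℝ)) := by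
  have hΛ0 : 0 ≤ Λ := (abs_nonneg _).trans (hΛ c)
  have hslip : ∀ τ, |w τ| ≤ Λ * |τ - c| := abs_slip_le hw hΛ hwc
  rw [(re_pairing_transport_eq hY hY'c hY2 hwY2 hwY'2 hw hΛ hwc).2]
  have hI := integrable_abs_weight_mul_norm_sq hY2 hwY2
  have hpt : ∀ τ : ℝ, |(w τ + (τ - c) * deriv w τ) * ‖Y τ‖ ^ 2| ≤ 2 * Λ * (|τ - c| * ‖Y τ‖ ^ 2) := by
    intro τ
    rw [abs_mul, abs_of_nonneg (by positivity : (0:ℝ) ≤ ‖Y τ‖ ^ 2)]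
    have hb : |w τ + (τ - c) * deriv w τ| ≤ 2 * Λ * |τ - c| := by
      calc |w τ + (τ - c) * deriv w τ| ≤ |w τ| + |(τ - c) * deriv w τ| := abs_add_le _ _
        _ = |w τ| + |τ - c| * |deriv w τ| := by rw [abs_mul]
        _ ≤ Λ * |τ - c| + |τ - c| * Λ := by gcongr; exacts [hslip τ, hΛ τ]
        _ = 2 * Λ * |τ - c| := by ring
    calc |w τ + (τ - c) * deriv w τ| * ‖Y τ‖ ^ 2 ≤ 2 * Λ * |τ - c| * ‖Y τ‖ ^ 2 := by gcongr
      _ = 2 * Λ * (|τ - c| * ‖Y τ‖ ^ 2) := by ring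
  have hb := (abs_integral_le_integral_abs (f := fun τ : ℝ => (w τ + (τ - c) * deriv w τ) * ‖Y τ‖ ^ 2)).trans
    (integral_mono_of_nonneg (Eventually.of_forall fun τ => abs_nonneg _) (hI.const_mul (2 * Λ))
      (Eventually.of_forall hpt))
  rw [integral_const_mul] at hb
  have hCS := integral_abs_weight_mul_norm_sq_le hY2 hwY2
  rw [abs_mul, abs_of_nonneg (by norm_num : (0:ℝ) ≤ 1 / 2)]
  calc 1 / 2 * |∫ τ : ℝ, (w τ + (τ - c) * deriv w τ) * ‖Y τ‖ ^ 2| ≤ 1 / 2 * (2 * Λ * ∫ τ : ℝ, |τ - c| * ‖Y τ‖ ^ 2) := by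
        gcongr
    _ = Λ * ∫ τ : ℝ, |τ - c| * ‖Y τ‖ ^ 2 := by ring
    _ ≤ Λ * ((∫ τ : ℝ, ‖((τ - c : ℝ) : ℂ) * Y τ‖ ^ 2) ^ (1 / 2 : ℝ) * (∫ τ : ℝ, ‖Y τ‖ ^ 2) ^ (1 / 2 : ℝ)) :=
        mul_le_mul_of_nonneg_left hCS hΛ0

/-! ## §3 The local (multiplier) terms in the pairing -/

/-- **Local terms**: for bounded multipliers `‖β₁‖ ≤ b₁`, `‖β₂‖ ≤ b₂`,
`‖∫ (β₁Y + β₂conj Y)·conj Y·(τ−c)‖ ≤ (b₁ + b₂)·(∫‖(τ−c)Y‖²)^{1/2}·(∫‖Y‖²)^{1/2}`. [folklore] -/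
theorem norm_pairing_multiplier_le {Y β₁ β₂ : ℝ → ℂ} {b₁ b₂ c : ℝ} (hb₁ : ∀ τ, ‖β₁ τ‖ ≤ b₁) (hb₂ : ∀ τ, ‖β₂ τ‖ ≤ b₂)
    (hY2 : MemLp Y 2) (hwY2 : MemLp (fun τ : ℝ => ((τ - c : ℝ) : ℂ) * Y τ) 2) :
    ‖∫ τ : ℝ, (β₁ τ * Y τ + β₂ τ * conj (Y τ)) * conj (Y τ) * ((τ - c : ℝ) : ℂ)‖
      ≤ (b₁ + b₂) * ((∫ τ : ℝ, ‖((τ - c : ℝ) : ℂ) * Y τ‖ ^ 2) ^ (1 / 2 : ℝ) * (∫ τ : ℝ, ‖Y τ‖ ^ 2) ^ (1 / 2 : ℝ)) := by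
  have hb0 : 0 ≤ b₁ + b₂ := add_nonneg ((norm_nonneg _).trans (hb₁ 0)) ((norm_nonneg _).trans (hb₂ 0))
  have hI := integrable_abs_weight_mul_norm_sq hY2 hwY2
  have hpt : ∀ τ : ℝ, ‖(β₁ τ * Y τ + β₂ τ * conj (Y τ)) * conj (Y τ) * ((τ - c : ℝ) : ℂ)‖
      ≤ (b₁ + b₂) * (|τ - c| * ‖Y τ‖ ^ 2) := by
    intro τ
    rw [norm_mul, norm_mul, Complex.norm_conj, Complex.norm_real, Real.norm_eq_abs]
    have hA : ‖β₁ τ * Y τ + β₂ τ * conj (Y τ)‖ ≤ (b₁ + b₂) * ‖Y τ‖ := by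
      calc ‖β₁ τ * Y τ + β₂ τ * conj (Y τ)‖ ≤ ‖β₁ τ * Y τ‖ + ‖β₂ τ * conj (Y τ)‖ := norm_add_le _ _
        _ = ‖β₁ τ‖ * ‖Y τ‖ + ‖β₂ τ‖ * ‖Y τ‖ := by rw [norm_mul, norm_mul, Complex.norm_conj]
        _ ≤ b₁ * ‖Y τ‖ + b₂ * ‖Y τ‖ := by gcongr; exacts [hb₁ τ, hb₂ τ]
        _ = (b₁ + b₂) * ‖Y τ‖ := by ring
    calc ‖β₁ τ * Y τ + β₂ τ * conj (Y τ)‖ * ‖Y τ‖ * |τ - c| ≤ (b₁ + b₂) * ‖Y τ‖ * ‖Y τ‖ * |τ - c| := by gcongr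
      _ = (b₁ + b₂) * (|τ - c| * ‖Y τ‖ ^ 2) := by ring
  refine (norm_integral_le_of_norm_le (hI.const_mul (b₁ + b₂)) (Eventually.of_forall hpt)).trans ?_
  rw [integral_const_mul]
  exact mul_le_mul_of_nonneg_left (integral_abs_weight_mul_norm_sq_le hY2 hwY2) hb0

/-! ## §4 The full-model band estimate -/

/-- **THE FULL-MODEL BAND ESTIMATE (Mourre inequality with transport and local terms, DESIGN-NOTE §4).**
Let `q, G > 0`, `σ₀, c : ℝ`; `Y ∈ C¹` with `Y ∈ L¹ ∩ L²`, `x·Y ∈ L¹`, `Y′` continuous, `(τ−c)Y, (τ−c)Y′ ∈ L²`, `M_qY ∈ L²`, band-localised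
(`Ŷ(z) = ∫Y e^{izx} = 0` wherever `𝔖′(z√q) < σ₀`); `w` a real differentiable slip with `w(c) = 0`, `|w′| ≤ Λ`; `β₁, β₂` measurable with `‖β₁‖ ≤ b₁`,
`‖β₂‖ ≤ b₂`.  Then for the 1-D model operator `𝓛Y = iG·M_qY − wY′ + β₁Y + β₂conj Y`:
`G·(σ₀/√q)·∫‖Y‖² ≤ ((∫‖𝓛Y‖²)^{1/2} + (Λ + b₁ + b₂)·(∫‖Y‖²)^{1/2})·(∫‖(τ−c)Y‖²)^{1/2}`.
[folklore; DESIGN-NOTE-28296 §4 at model level] -/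
theorem model_band_estimate {q G σ₀ : ℝ} (hq : 0 < q) (hG : 0 < G) {Y Y' : ℝ → ℂ} (hY : ∀ τ, HasDerivAt Y (Y' τ) τ)
    (hY'c : Continuous Y') (hY1 : Integrable Y) (hY2 : MemLp Y 2) (hxY : Integrable (fun x : ℝ => x • Y x)) (c : ℝ)
    (hwY2 : MemLp (fun τ : ℝ => ((τ - c : ℝ) : ℂ) * Y τ) 2) (hwY'2 : MemLp (fun τ : ℝ => ((τ - c : ℝ) : ℂ) * Y' τ) 2)
    (hM2 : MemLp (fun τ : ℝ => (2 / q : ℂ) * Y τ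
      - ∫ σ : ℝ, ((((2 * q - (τ - σ) ^ 2) * (((τ - σ) ^ 2 + q) ^ (5 / 2 : ℝ))⁻¹ : ℝ)) : ℂ) * Y σ) 2)
    (hsupp : ∀ z : ℝ, deriv liaSym (z * √q) < σ₀ → ∫ x : ℝ, Y x * cexp (I * z * x) = 0)
    {w : ℝ → ℝ} (hw : Differentiable ℝ w) {Λ : ℝ} (hΛ : ∀ t, |deriv w t| ≤ Λ) (hwc : w c = 0)
    {β₁ β₂ : ℝ → ℂ} (hβ₁m : AEStronglyMeasurable β₁ volume) (hβ₂m : AEStronglyMeasurable β₂ volume) {b₁ b₂ : ℝ}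
    (hb₁ : ∀ τ, ‖β₁ τ‖ ≤ b₁) (hb₂ : ∀ τ, ‖β₂ τ‖ ≤ b₂) :
    G * (σ₀ / √q) * ∫ x : ℝ, ‖Y x‖ ^ 2
      ≤ ((∫ τ : ℝ, ‖I * (G : ℂ) * ((2 / q : ℂ) * Y τ
              - ∫ σ : ℝ, ((((2 * q - (τ - σ) ^ 2) * (((τ - σ) ^ 2 + q) ^ (5 / 2 : ℝ))⁻¹ : ℝ)) : ℂ) * Y σ)
            - ((w τ : ℝ) : ℂ) * Y' τ + β₁ τ * Y τ + β₂ τ * conj (Y τ)‖ ^ 2) ^ (1 / 2 : ℝ)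
          + (Λ + b₁ + b₂) * (∫ τ : ℝ, ‖Y τ‖ ^ 2) ^ (1 / 2 : ℝ))
        * (∫ τ : ℝ, ‖((τ - c : ℝ) : ℂ) * Y τ‖ ^ 2) ^ (1 / 2 : ℝ) := by
  have hYc : Continuous Y := continuous_iff_continuousAt.2 fun t => (hY t).continuousAt
  -- abbreviations
  set MY : ℝ → ℂ := fun τ => (2 / q : ℂ) * Y τ
      - ∫ σ : ℝ, ((((2 * q - (τ - σ) ^ 2) * (((τ - σ) ^ 2 + q) ^ (5 / 2 : ℝ))⁻¹ : ℝ)) : ℂ) * Y σ with hMYdef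
  set TY : ℝ → ℂ := fun τ => -(((w τ : ℝ) : ℂ) * Y' τ) with hTYdef
  set BY : ℝ → ℂ := fun τ => β₁ τ * Y τ + β₂ τ * conj (Y τ) with hBYdef
  set LY : ℝ → ℂ := fun τ => I * (G : ℂ) * MY τ - ((w τ : ℝ) : ℂ) * Y' τ + β₁ τ * Y τ + β₂ τ * conj (Y τ) with hLYdef
  -- `L²` membership of the pieces
  have hSY2 : MemLp (fun τ => I * (G : ℂ) * MY τ) 2 := hM2.const_mul (I * (G : ℂ))
  have hTY2 : MemLp TY 2 := (memLp_slip_mul hY'c.aestronglyMeasurable hwY'2 hw hΛ hwc).neg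
  have hBY2 : MemLp BY 2 :=
    (memLp_boundedMultiplier_mul hβ₁m hb₁ hY2).add (memLp_boundedMultiplier_mul hβ₂m hb₂ (memLp_conj hY2))
  have hLY2 : MemLp LY 2 := by
    refine ((hSY2.add hTY2).add hBY2).ae_eq (Eventually.of_forall fun τ => ?_)
    simp only [Pi.add_apply, hTYdef, hBYdef, hLYdef]
    ring
  -- the four pairings
  have hPM := integrable_pairing hM2 hwY2
  have hPS := integrable_pairing hSY2 hwY2
  have hPT := integrable_pairing hTY2 hwY2
  have hPB := integrable_pairing hBY2 hwY2
  -- the pairing of `LY` splits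
  have hsplit : ∫ τ : ℝ, LY τ * conj (Y τ) * ((τ - c : ℝ) : ℂ)
      = I * (G : ℂ) * (∫ τ : ℝ, MY τ * conj (Y τ) * ((τ - c : ℝ) : ℂ))
        + (∫ τ : ℝ, TY τ * conj (Y τ) * ((τ - c : ℝ) : ℂ))
        + ∫ τ : ℝ, BY τ * conj (Y τ) * ((τ - c : ℝ) : ℂ) := by
    have e : (fun τ : ℝ => LY τ * conj (Y τ) * ((τ - c : ℝ) : ℂ))
        = fun τ : ℝ => (I * (G : ℂ) * (MY τ * conj (Y τ) * ((τ - c : ℝ) : ℂ)) + TY τ * conj (Y τ) * ((τ - c : ℝ) : ℂ))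
          + BY τ * conj (Y τ) * ((τ - c : ℝ) : ℂ) := by
      ext τ
      simp only [hTYdef, hBYdef, hLYdef]
      ring
    have hI0 : Integrable (fun τ : ℝ => I * (G : ℂ) * (MY τ * conj (Y τ) * ((τ - c : ℝ) : ℂ))) := hPM.const_mul _
    have hI1 : Integrable (fun τ : ℝ => I * (G : ℂ) * (MY τ * conj (Y τ) * ((τ - c : ℝ) : ℂ))
        + TY τ * conj (Y τ) * ((τ - c : ℝ) : ℂ)) := hI0.add hPT
    rw [e, integral_add hI1 hPB, integral_add hI0 hPT, integral_const_mul]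
  -- §1: band gain; §2: transport; §3: local terms
  have hgain := re_I_mul_pairing_modelSelf_ge hq hYc hY1 hY2 hxY c hwY2 hM2 hsupp
  have htr := abs_re_pairing_transport_le hY hY'c hY2 hwY2 hwY'2 hw hΛ hwc
  have hloc := norm_pairing_multiplier_le (c := c) hb₁ hb₂ hY2 hwY2
  have hCS := norm_pairing_le hLY2 hwY2
  -- abbreviate the real numbers
  set nL : ℝ := (∫ τ : ℝ, ‖LY τ‖ ^ 2) ^ (1 / 2 : ℝ) with hnL
  set nW : ℝ := (∫ τ : ℝ, ‖((τ - c : ℝ) : ℂ) * Y τ‖ ^ 2) ^ (1 / 2 : ℝ) with hnW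
  set nY : ℝ := (∫ τ : ℝ, ‖Y τ‖ ^ 2) ^ (1 / 2 : ℝ) with hnY
  set PM : ℂ := ∫ τ : ℝ, MY τ * conj (Y τ) * ((τ - c : ℝ) : ℂ) with hPMdef
  set PT : ℂ := ∫ τ : ℝ, TY τ * conj (Y τ) * ((τ - c : ℝ) : ℂ) with hPTdef
  set PB : ℂ := ∫ τ : ℝ, BY τ * conj (Y τ) * ((τ - c : ℝ) : ℂ) with hPBdef
  set PL : ℂ := ∫ τ : ℝ, LY τ * conj (Y τ) * ((τ - c : ℝ) : ℂ) with hPLdef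
  -- real parts: `Re PL = G·Re(i·PM) + Re PT + Re PB`
  have hreal : PL.re = G * (I * PM).re + PT.re + PB.re := by
    rw [hsplit]
    simp only [Complex.add_re]
    rw [show I * (G : ℂ) * PM = (G : ℂ) * (I * PM) by ring, Complex.re_ofReal_mul]
  have h1 : G * (σ₀ / √q * ∫ x : ℝ, ‖Y x‖ ^ 2) ≤ G * (I * PM).re := mul_le_mul_of_nonneg_left hgain hG.le
  have h2 : G * (I * PM).re = PL.re - PT.re - PB.re := by rw [hreal]; ring
  have h3 : PL.re ≤ nL * nW := (Complex.re_le_norm _).trans hCS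
  have h4 : -PT.re ≤ Λ * (nW * nY) := (neg_le_abs _).trans htr
  have h5 : -PB.re ≤ (b₁ + b₂) * (nW * nY) := by
    refine (neg_le_abs _).trans ((Complex.abs_re_le_norm _).trans hloc)
  calc G * (σ₀ / √q) * ∫ x : ℝ, ‖Y x‖ ^ 2 = G * (σ₀ / √q * ∫ x : ℝ, ‖Y x‖ ^ 2) := by ring
    _ ≤ G * (I * PM).re := h1
    _ = PL.re + -PT.re + -PB.re := by rw [h2]; ring
    _ ≤ nL * nW + Λ * (nW * nY) + (b₁ + b₂) * (nW * nY) := by gcongr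
    _ = (nL + (Λ + b₁ + b₂) * nY) * nW := by ring

end Summit.NavierStokesRegularity.NavierStokesRegularity.Theorems.MatchedKernel

end
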